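import Summits.AtomisticToContinuum.BoseEinsteinCondensation.Theorems.BECThomsonPrincipleGDTransferSeededSpectralClosed
import Summits.AtomisticToContinuum.BoseEinsteinCondensation.Theorems.BECThomsonPrincipleGDTransferSeededSmoothSplittingInt
import Summits.AtomisticToContinuum.BoseEinsteinCondensation.Theorems.BECThomsonPrincipleGDTransferSeededPinchingBoundInt
import Summits.AtomisticToContinuum.BoseEinsteinCondensation.Theorems.BECThomsonPrincipleGDTransferSeededSpectralSeedInt
import Summits.AtomisticToContinuum.BoseEinsteinCondensation.Theorems.BECThomsonPrincipleGDTransferSeededKyFanGapFloorZero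

/-!
# Route `BECThomsonPrinciple`, crux `GDTransfer` (stmt-AtomisticToContinuum-9482), line `seeded-continuity` —
# the spectral seed for the INTEGRABLE class, closed (lead c4, wave 3)

Supports (does not close) stmt-AtomisticToContinuum-9482.  The integrable twins `smoothSplittingInt`, `pinchingBoundInt` and the assembly
`seedForInt_of_kyFanGapFloor` (Defs `…SeededSpectralIntDefs` p165276) are LANDED, so the spectral door and skeleton v8's soft class coincide:

* `noBalancedCatForInt_of_kyFanGapFloor` — the seed at every admissible profile finite on `[0,∞)` with integrable lift follows from a Ky Fan gap
  floor `K/L³` on the dilute path;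
* `integrable_periodicBEC_of_gd_of_kyFanGapFloor` — **Gaussian domination + Ky Fan gap floor ⇒ periodic BEC for every admissible profile with
  integrable lift** (registered glue), over `ivtGlue_for`, `bandEmptiness_of_integrable`, `stub_freeCorner`, `localConstancy_of_integrable` (v8);
* `essIntegrable_periodicBEC_of_gd_of_kyFanGapFloor` — the same for `∫ v(|x|)dx < ∞` up to a.e. modification (`stub_roughNull`; the gap floor is
  asked of the integrable representative);
* `kyFanGapFloorFor_zero` (p165497) certifies the gap-floor statement at the free gas.

No `sorry`, no new definitions; the open statements enter only as hypotheses.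
-/

noncomputable section

open MeasureTheory Filter
open scoped ENNReal NNReal

namespace Summit.AtomisticToContinuum.BoseEinsteinCondensation.Cruxes.GDTransfer.Seeded

open Literature.MathematicalPhysics.QuantumManyBody.BoseGas
open Summit.AtomisticToContinuum.BoseEinsteinCondensation.Theses.BECThomsonPrinciple
open Summit.AtomisticToContinuum.BoseEinsteinCondensation.Cruxes.GDTransfer.DysonDressedWitness
  (PeriodicBECFor gdTransfer_iff)

/-- **The seed at an integrable potential from a Ky Fan gap floor.** -/
theorem noBalancedCatForInt_of_kyFanGapFloor (v : ℝ → ℝ≥0∞) (hv : IsRepulsiveFiniteRange v) (hi : IsIntegrableProfile v)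
    (hgap : KyFanGapFloorFor v) : NoBalancedCatFor v :=
  seedForInt_of_kyFanGapFloor smoothBlockAlgebra smoothSplittingInt pinchingBoundInt catKyFan v hv hi hgap

/-- **Gaussian domination + Ky Fan gap floor ⇒ periodic BEC, integrable class** (registered glue). -/
theorem integrable_periodicBEC_of_gd_of_kyFanGapFloor : Summit.AtomisticToContinuum.BoseEinsteinCondensation.Theses.BECThomsonPrinciple.GaussianDominationCan → ∀ v : ℝ → ℝ≥0∞, IsRepulsiveFiniteRange v → IsIntegrableProfile v → KyFanGapFloorFor v → PeriodicBECFor v :=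
  fun hG v hv hi hgap => ivtGlue_for stub_countLaw v hv (noBalancedCatForInt_of_kyFanGapFloor v hv hi hgap)
    (bandEmptiness_of_integrable hG v hv hi) (stub_freeCorner v hv) (localConstancy_of_integrable v hv hi)

/-- … and for every admissible profile a.e. equal to an integrable one carrying the gap floor. -/
theorem essIntegrable_periodicBEC_of_gd_of_kyFanGapFloor (hG : GaussianDominationCan) (v w : ℝ → ℝ≥0∞)
    (hv : IsRepulsiveFiniteRange v) (hw : IsRepulsiveFiniteRange w) (hwi : IsIntegrableProfile w)
    (hae : ∀ᵐ x : Space, v ‖x‖ = w ‖x‖) (hgap : KyFanGapFloorFor w) : PeriodicBECFor v :=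
  stub_roughNull v w hv hw hae (integrable_periodicBEC_of_gd_of_kyFanGapFloor hG w hw hwi hgap)

end Summit.AtomisticToContinuum.BoseEinsteinCondensation.Cruxes.GDTransfer.Seeded

end
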